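import Summits.AnomalousDissipation.AnomalousDissipation.Theorems.SolenoidalFractalHomogenisationLagrangianStepCellChainDefs
import Literature.Analysis.FluidPDE.PassiveVectorTensorTwistedModalSymbol
import HarnessLib

/-!
# K1L_D `LagrangianRenormalisationStepDesign` (stmt-AnomalousDissipation-27980), registered stub `stub_D1_V0θg` (v28, ruling D28-3 (3)), port-map layer L2:
# the TWISTED chain right-hand side and the continuous MODE REPRESENTATIVE of a weak solution of the FROZEN-FRAME tensor cell problem
# (shared definitions; reviewed; `--kind definition --supports stmt-AnomalousDissipation-27980 --as helper`)

Summits-side definitions file of route `SolenoidalFractalHomogenisation` (prover seat `ad-k1l-cellLawV-w1` g9; port map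
`Cruxes/LagrangianRenormalisationStepDesign/Lines/onelevel-vtheta-twist-portmap.md` §3 L2).  Two definitions with bodies, unfolding lemmas, no theorems of
substance, no named facts, no sorry.  The frozen-frame twin of `…CellChainDefs`: for a lattice word `W₁`, a cell number `n`, a constant viscosity tensor `𝔹`,
a CONSTANT frame `G₀ : Matrix (Fin 3) (Fin 3) ℝ` and a weak solution `u` of `∂ₜu + (b·∇)u + G₀ᵀ∇π = 𝓛^{G₀}_𝔹 u`, `∇·(G₀ u) = 0` along the cell carrier `b = W₁.cell n`
(`Torus.IsWeakTensorPassiveVectorDistortedOn 0 T 𝔹 (W₁.cell n) (fun _ _ => G₀) F u`; the cell member of `VmodDist.SlowVectorClauseFθg` has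
`W₁ = (W.stretch M).stretch (1/ν)`, `𝔹 = (1/n²)•𝔸`, `cellField_eq_cell`), the chain ODE of `…CellChainLinksFrame.ae_inner_mFourierCoeff_eq_cell_frame` is the flat one with
two substitutions (`Literature/…/PassiveVectorTensorDistortedConstFrameFourier`, `…TwistedModalSymbol`): the Leray projection at `k` becomes
`P^θ_k := transversalProjR (twistFreq G₀ k)` (projection onto `(G₀ᵀk)^⊥`) and the forward symbol becomes that of the conjugated tensor
`T_{(𝔹^{G₀})ᵀ}(k) = Torus.symbT (Torus.majorTranspose (Torus.Visc4.conj G₀ 𝔹)) k`; the link coefficients `linkCoeff W₁ n k j τ` (flat `êⱼ·k`) are UNCHANGED.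

* `modeRHSθ W₁ n 𝔹 G₀ u k τ` — the TWISTED CHAIN RIGHT-HAND SIDE of mode `k` at time `τ` on the a.e.-defined Fourier coefficients `û(τ) = 𝓕(complexify ∘ u τ)`:
  `−4π² P^θ_k T_{(𝔹^{G₀})ᵀ}(k) û(τ)(k) − Σⱼ linkCoeffⱼ(k,τ) • P^θ_k (aⱼ • û(τ)(k − Kⱼ) + a′ⱼ • û(τ)(k + Kⱼ))`;
* `modeRepθ W₁ n 𝔹 G₀ F u k t = P^θ_k F̂(k) + ∫₀ᵗ modeRHSθ … k τ dτ` — the continuous (absolutely continuous) REPRESENTATIVE of the mode `t ↦ û(t)(k)`;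
* `modeRHSθ_one` / `modeRepθ_one` — at `G₀ = 1` these ARE `modeRHS` / `modeRep` (`transversalProjR_intCast`, `twistFreq_one`, `conj_one`).
The facts (`modeRepθ = û` a.e., twisted transversality `rdot (twistFreq G₀ k) (modeRepθ …) = 0`, a.e. `HasDerivAt`, absolute continuity) are proved in
`…CellChainModesFrame`.  NOT a proof of anything; rung F-D1.A0 infrastructure; AD NOT proved.
-/

set_option linter.dupNamespace false

noncomputable section

namespace Summit.AnomalousDissipation.AnomalousDissipation.Theorems.SolenoidalFractalHomogenisation.LagrangianStep.CellChain

open Set MeasureTheory Complex UnitAddTorus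
open scoped InnerProductSpace
open Literature.Analysis Literature.Analysis.FunctionSpaces Literature.Analysis.FunctionSpaces.Torus
open Literature.Analysis.FluidPDE Literature.Analysis.FluidPDE.LatticeShear

variable {k₀ : ℕ}

/-- **The twisted chain right-hand side** of mode `k` at time `τ` of a field `u` along the cell carrier `W₁.cell n` with viscosity tensor `𝔹` in the
constant frame `G₀`, read on the (a.e.-defined) Fourier coefficients `û(τ) = 𝓕(complexify ∘ u τ)`:
`modeRHSθ = −4π² • P^θ_k (T_{(𝔹^{G₀})ᵀ}(k) û(τ)(k)) − Σⱼ linkCoeffⱼ(k,τ) • P^θ_k (aⱼ • û(τ)(k − Kⱼ) + a′ⱼ • û(τ)(k + Kⱼ))`,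
`P^θ_k = transversalProjR (twistFreq G₀ k)`, `𝔹^{G₀} = Visc4.conj G₀ 𝔹`.
[cite: MeshalkinSinai1961, pp. 1700–1705] [cite: ArmstrongVicol2025, §4.1 (PDF p. 34)] -/
def modeRHSθ (W₁ : LatticeWord k₀) (n : ℕ) (𝔹 : Torus.Visc4 (Fin 3)) (G₀ : Matrix (Fin 3) (Fin 3) ℝ)
    (u : ℝ → UnitAddTorus (Fin 3) → EuclideanSpace ℝ (Fin 3)) (k : Fin 3 → ℤ) (τ : ℝ) : EuclideanSpace ℂ (Fin 3) :=
  -(((4 * Real.pi ^ 2 : ℝ) : ℂ) • Torus.transversalProjR (Torus.twistFreq G₀ k)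
      (Torus.symbT (Torus.majorTranspose (Torus.Visc4.conj G₀ 𝔹)) k (mFourierCoeff (EuclideanSpace.complexify ∘ u τ) k))) -
    ∑ j, linkCoeff W₁ n k j τ • Torus.transversalProjR (Torus.twistFreq G₀ k)
      ((Complex.exp ((W₁.phase j).φ * Complex.I) * (1 / (2 * ((2 * Real.pi * ‖latticeVec (W₁.phase j).m‖ : ℝ) : ℂ) * Complex.I))) •
          mFourierCoeff (EuclideanSpace.complexify ∘ u τ) (k - fun i => (W₁.phase j).m i * n) +
        (starRingEnd ℂ (Complex.exp ((W₁.phase j).φ * Complex.I)) *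
            (-(1 / (2 * ((2 * Real.pi * ‖latticeVec (W₁.phase j).m‖ : ℝ) : ℂ) * Complex.I)))) •
          mFourierCoeff (EuclideanSpace.complexify ∘ u τ) (k + fun i => (W₁.phase j).m i * n))

/-- Unfolding `modeRHSθ`. [cite: MeshalkinSinai1961, pp. 1700–1705] -/
theorem modeRHSθ_def (W₁ : LatticeWord k₀) (n : ℕ) (𝔹 : Torus.Visc4 (Fin 3)) (G₀ : Matrix (Fin 3) (Fin 3) ℝ)
    (u : ℝ → UnitAddTorus (Fin 3) → EuclideanSpace ℝ (Fin 3)) (k : Fin 3 → ℤ) (τ : ℝ) :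
    modeRHSθ W₁ n 𝔹 G₀ u k τ =
      -(((4 * Real.pi ^ 2 : ℝ) : ℂ) • Torus.transversalProjR (Torus.twistFreq G₀ k)
          (Torus.symbT (Torus.majorTranspose (Torus.Visc4.conj G₀ 𝔹)) k (mFourierCoeff (EuclideanSpace.complexify ∘ u τ) k))) -
        ∑ j, linkCoeff W₁ n k j τ • Torus.transversalProjR (Torus.twistFreq G₀ k)
          ((Complex.exp ((W₁.phase j).φ * Complex.I) * (1 / (2 * ((2 * Real.pi * ‖latticeVec (W₁.phase j).m‖ : ℝ) : ℂ) * Complex.I))) •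
              mFourierCoeff (EuclideanSpace.complexify ∘ u τ) (k - fun i => (W₁.phase j).m i * n) +
            (starRingEnd ℂ (Complex.exp ((W₁.phase j).φ * Complex.I)) *
                (-(1 / (2 * ((2 * Real.pi * ‖latticeVec (W₁.phase j).m‖ : ℝ) : ℂ) * Complex.I)))) •
              mFourierCoeff (EuclideanSpace.complexify ∘ u τ) (k + fun i => (W₁.phase j).m i * n)) := rfl

/-- **The continuous representative of the mode `k` in the frame `G₀`** of a weak solution `u` from the datum `F`:
`modeRepθ t = P^θ_k F̂(k) + ∫₀ᵗ modeRHSθ … k τ dτ` (interval integral; the twisted Leray projection of the datum coefficient makes the representative transversal to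
`G₀ᵀk` for every datum — for a `G₀`-solenoidal `F` it is `F̂(k)` itself). [cite: Temam1984, Ch. III §1.1] [cite: ArmstrongVicol2025, §4.1 (PDF p. 34)] -/
def modeRepθ (W₁ : LatticeWord k₀) (n : ℕ) (𝔹 : Torus.Visc4 (Fin 3)) (G₀ : Matrix (Fin 3) (Fin 3) ℝ) (F : UnitAddTorus (Fin 3) → EuclideanSpace ℝ (Fin 3))
    (u : ℝ → UnitAddTorus (Fin 3) → EuclideanSpace ℝ (Fin 3)) (k : Fin 3 → ℤ) (t : ℝ) : EuclideanSpace ℂ (Fin 3) :=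
  Torus.transversalProjR (Torus.twistFreq G₀ k) (mFourierCoeff (EuclideanSpace.complexify ∘ F) k) + ∫ τ in (0:ℝ)..t, modeRHSθ W₁ n 𝔹 G₀ u k τ

/-- Unfolding `modeRepθ`. [cite: Temam1984, Ch. III §1.1] -/
theorem modeRepθ_def (W₁ : LatticeWord k₀) (n : ℕ) (𝔹 : Torus.Visc4 (Fin 3)) (G₀ : Matrix (Fin 3) (Fin 3) ℝ)
    (F : UnitAddTorus (Fin 3) → EuclideanSpace ℝ (Fin 3)) (u : ℝ → UnitAddTorus (Fin 3) → EuclideanSpace ℝ (Fin 3)) (k : Fin 3 → ℤ) (t : ℝ) :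
    modeRepθ W₁ n 𝔹 G₀ F u k t =
      Torus.transversalProjR (Torus.twistFreq G₀ k) (mFourierCoeff (EuclideanSpace.complexify ∘ F) k) +
        ∫ τ in (0:ℝ)..t, modeRHSθ W₁ n 𝔹 G₀ u k τ := rfl

/-- The representative starts at the twisted-Leray-projected datum coefficient: `modeRepθ 0 = P^θ_k F̂(k)`. [cite: Temam1984, Ch. III §1.1] -/
theorem modeRepθ_zero (W₁ : LatticeWord k₀) (n : ℕ) (𝔹 : Torus.Visc4 (Fin 3)) (G₀ : Matrix (Fin 3) (Fin 3) ℝ)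
    (F : UnitAddTorus (Fin 3) → EuclideanSpace ℝ (Fin 3)) (u : ℝ → UnitAddTorus (Fin 3) → EuclideanSpace ℝ (Fin 3)) (k : Fin 3 → ℤ) :
    modeRepθ W₁ n 𝔹 G₀ F u k 0 = Torus.transversalProjR (Torus.twistFreq G₀ k) (mFourierCoeff (EuclideanSpace.complexify ∘ F) k) := by
  rw [modeRepθ_def, intervalIntegral.integral_same, add_zero]

/-- **Consistency at the identity frame**: `modeRHSθ … 1 … = modeRHS …` (`P^θ_k = P_k` by `transversalProjR_intCast ∘ twistFreq_one`, `𝔹^{1} = 𝔹`).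
[cite: MeshalkinSinai1961, pp. 1700–1705] -/
theorem modeRHSθ_one (W₁ : LatticeWord k₀) (n : ℕ) (𝔹 : Torus.Visc4 (Fin 3))
    (u : ℝ → UnitAddTorus (Fin 3) → EuclideanSpace ℝ (Fin 3)) (k : Fin 3 → ℤ) (τ : ℝ) :
    modeRHSθ W₁ n 𝔹 1 u k τ = modeRHS W₁ n 𝔹 u k τ := by
  rw [modeRHSθ_def, modeRHS_def, Torus.twistFreq_one, Torus.transversalProjR_intCast, Torus.Visc4.conj_one]

/-- **Consistency at the identity frame**: `modeRepθ … 1 … = modeRep …`. [cite: Temam1984, Ch. III §1.1] -/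
theorem modeRepθ_one (W₁ : LatticeWord k₀) (n : ℕ) (𝔹 : Torus.Visc4 (Fin 3))
    (F : UnitAddTorus (Fin 3) → EuclideanSpace ℝ (Fin 3)) (u : ℝ → UnitAddTorus (Fin 3) → EuclideanSpace ℝ (Fin 3)) (k : Fin 3 → ℤ) (t : ℝ) :
    modeRepθ W₁ n 𝔹 1 F u k t = modeRep W₁ n 𝔹 F u k t := by
  rw [modeRepθ_def, modeRep_def, Torus.twistFreq_one, Torus.transversalProjR_intCast]
  simp_rw [modeRHSθ_one]

end Summit.AnomalousDissipation.AnomalousDissipation.Theorems.SolenoidalFractalHomogenisation.LagrangianStep.CellChain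

end
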